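import Summits.ABC.IUTFork.Conditional.WRowLicenceSocketM
import Summits.ABC.IUTFork.Cor312LicenceTripleUnconditional
import Summits.ABC.IUTFork.Cor312PilotIdelesMReadDeep
import HarnessLib

/-!
# Branch C / R-W, reading (U), M line: the (xi-f) licence at the M-LEVEL setting of the own ideles of the datum of ANY abc triple, UNCONDITIONALLY
# in the local type — the M twin of abc-iut-W-row-1's triple socket, with the SAME arithmetic hypothesis `hcell` (abc-iut cell, branch C, row
# «C:COR312U-EVENTUAL-M», file B1 = the triple socket; seat abc-iut-C-cert-2 gen 7; C-lead ruling C-R108 (b))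

Record-only PROOF file (D-0012; 0 definitions, 0 `Prop` facts, nothing re-typed) of the abc-iut cell. TAKES NO SIDE on [IUTchIII] Cor. 3.12
(S. Mochizuki, *Inter-universal Teichmüller theory III*, Cor. 3.12 p. 173–174; Step (xi-f) p. 184) or on any author; «inhabited as typed» ≠
«asserted in print».

abc-iut-W-row-1's `WRow.licence_triple_unconditional` (`Cor312LicenceTripleUnconditional`) proves the hull licence of the K-LEVEL setting at every
genuine Θ-datum `T` over the Frey point `λ = a/c` of an abc triple from the purely arithmetic hypothesis `hcell` (per odd prime `p ∣ abc`, `p ≠ l`,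
and every admissible index `e`: `e` off the cyclotomic indices and the integer cells `e·⌊(j²P − j·D − (j+1)·ρin)/e⌋ + (j+1)·ρout ≤ P`). THIS FILE
proves, from the SAME `hcell`, the licence of the M-LEVEL setting of the datum's own ideles (`settingPrVolSharpM T.D … (tOfIdeleData …) (tqM …) …`
— the setting of the M books of record), through file A's one-sided socket `WRowM.licence_tOfIdeleData_of_orders_rat`:

* the member `x ∈ V̲_u` of a BAD rational place sits on a place `w = placeOfM x` of `K` over `p = p_u`, and `w` IS the place of a K-fibre
  point `x'` (`fibreEquivPlacesOver`), BAD for the K datum (`mem_pilotDataOfK_S_iff`, `ThetaData.mk_mem_VFbad_iff`); so the tree's K-fibre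
  facts apply to it — `p ∣ abc`, `p ∉ {2, l}` (abc-iut-W-row-2 / C-cert-3), `l ∣ e`, `15·l ∣ e·v_p`, `(p−1) ∣ e` at `p ∣ 30`, the odd-pole
  twist `30·l ∣ e·v_p`, the wild different at `3, 5` (abc-iut-W-neg-1 / W-neg-2 / w4-d107) — `e(K_w/ℚ_p)` and `d(K_w)` being functions of the
  PLACE (`absRamificationIdx_rescaledCompletion`, `differentOrd_rescaledCompletion`);
* the inner slot witness and the envelope members are the generic ones of abc-iut-c312-5 / w4-d094 (`WRow.inner_witness_slot`,
  `WRow.inner_witness_trivial`, `WRow.outer_member_min`), in `K_w = kOfM …` directly;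
* `‖t_{q,x}‖ = p^{ord_p j(a/c)/(2l)} = p^{−2v_p(abc)/(2l)}` (abc-iut-w5-d033 `norm_tqM_eq_rpow_ord_rat`, W-ref-2 `Cor22.ord_jInv_ratPoint_triple_eq`).

* **`WRowM.licence_triple_unconditional`** — `Thm311ToCor312.Licence` at `settingPrVolSharpM T.D hlog (tOfIdeleData T.D r) (tqM … r) …` for
  EVERY idele datum `r` of `T.D`, every analytic `logv`, every context datum and ANY unit-set bookkeeping `htq0/Sq/htq1`, under W-row-1's `hcell`
  VERBATIM (so every arithmetic discharge of `hcell` in the tree — p501279 `4·abc < l`, p508140 SHARP `p < l ∧ 4·p^{⌊v_p/2⌋} < l` — serves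
  the M line unchanged: file B2).

HONEST SCOPE: OUR sharp containers and Dupuy–Hilado's typed (Ind1)/(Ind2); STRONGER-THAN-PRINT hull reading; non-emptiness of the datum type,
admissibility and Szpiro-badness NOT claimed; nothing about the printed GLOBAL inequality or the number-level corollary; typed ≠ proved;
instantiated ≠ endorsed; no abc claim. [cite: Mochizuki2012, IUTchI Def. 3.1 (b),(c),(e) pp. 61–62, Ex. 3.2 (iv) p. 71; IUTchIII Cor. 3.12
Step (xi-f) p. 184; IUTchIV Prop. 1.1 p. 9, Prop. 1.2 (i)(ii) p. 10, Prop. 1.4 (ii) p. 13, Cor. 2.2 (ii) proof (P5) p. 46] [cite: DupuyHilado2025,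
§3.3, §3.4, §3.9, §4.9, §4.12] [cite: NeukirchANT1999, Ch. II (5.5)] [cite: SilvermanATAEC1994, V.5 Thm. 5.3 and Cor. 5.4]
[claim: Mochizuki2012, status: disputed] for every IUT sentence. PROOF-ONLY: no definitions.
-/

noncomputable section

open Set Function Metric NumberField IsDedekindDomain

namespace Summit.ABC.IUTFork.Conditional

open Thm311 Thm311.Real Cor312 Cor312Vol Cor312Prov Literature.IUT.LogThetaLattice Literature.IUT.LogVolume
  Literature.IUT.HodgeTheaters Literature.IUT.LogVolume.Cor22
open Literature.NumberTheory.NumberFields Literature.NumberTheory.GaloisRepresentations.Ultrametric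
open Literature.NumberTheory.DiophantineGeometry Literature.NumberTheory.DiophantineGeometry.GenEll

/-- **THE LICENCE AT THE M-LEVEL SETTING OF THE OWN IDELES OF THE DATUM OF AN abc TRIPLE, UNCONDITIONAL IN THE LOCAL TYPE.** `a + b = c` an abc
triple with `j(a/c) ≠ 1728`, `l` any level, `T` ANY genuine Θ-volume datum at `(ratPoint (a/c), l)`, `r` ANY idele datum of `T.D`, exponents
`A, B : ℕ → ℕ`, and abc-iut-W-row-1's arithmetic hypothesis `hcell` VERBATIM ⟹ `Thm311ToCor312.Licence` at
`settingPrVolSharpM T.D hlog (tOfIdeleData T.D r) (tqM … r) …` for every analytic `logv`, every context datum, any `htq0/Sq/htq1`. Proof: file A's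
socket with, per bad member, W-row-1's per-prime data `(e, D, 2v_p, ρin, ρout)` read at the K-fibre point on the same place of `K`.
[cite: Mochizuki2012, IUTchI Def. 3.1 (b),(c),(e) pp. 61–62, Ex. 3.2 (iv) p. 71; IUTchIII Cor. 3.12 Step (xi-f) p. 184; IUTchIV Prop. 1.2 (i)(ii) p. 10,
Prop. 1.4 (ii) p. 13, Cor. 2.2 (ii) proof (P5) p. 46] [cite: DupuyHilado2025, §3.3, §3.4, §4.9, §4.12] [claim: Mochizuki2012, status: disputed] -/
theorem WRowM.licence_triple_unconditional {a b c l : ℕ} (habc : IsABCTriple a b c)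
    (hj1728 : Cor22.jInv ((a : ℚ) / c) ≠ 1728) (T : Cor22.ThetaVolumeDatumAt (ratPoint ((a : ℚ) / c)) l) (A B : ℕ → ℕ)
    (hcell : ∀ p : ℕ, p.Prime → p ∣ a * b * c → p ≠ 2 → p ≠ l → ∀ e : ℕ, 0 < e → l ∣ e →
      15 * l ∣ e * (a * b * c).factorization p → (p ∣ 30 → (p - 1) ∣ e) →
      (p ∣ c → Odd ((a * b * c).factorization p) → 30 * l ∣ e * (a * b * c).factorization p) →
      (∀ k : ℕ, (e : ℤ) ≠ (p : ℤ) ^ k * ((p : ℤ) - 1)) ∧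
      ∀ i : ℕ, i < (l - 1) / 2 →
        (e : ℤ) * ((((i + 1 : ℕ) : ℤ) ^ 2 * ((e * (2 * (a * b * c).factorization p) / (2 * l) : ℕ) : ℤ) -
            ((i + 1 : ℕ) : ℤ) * (((if p ∣ 30 ∧ ¬ p ∣ (a * b * c).factorization p then 2 * e - 1 else e - 1 : ℕ) : ℕ) : ℤ) -
            ((i + 2 : ℕ) : ℤ) * (if p ∣ 30 then (((e / (p - 1) : ℕ) : ℤ)) else (1 : ℤ))) / (e : ℤ)) +
          ((i + 2 : ℕ) : ℤ) * min ((p : ℤ) ^ A p - (A p : ℤ) * (e : ℤ)) ((p : ℤ) ^ B p - (B p : ℤ) * (e : ℤ)) ≤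
        ((e * (2 * (a * b * c).factorization p) / (2 * l) : ℕ) : ℤ))
    :
    letI := T.instFieldF; letI := T.instNumberFieldF; letI := T.instAlgebraF; letI := T.instFieldK
    letI := T.instNumberFieldK; letI := T.instAlgebraK; letI := T.instFieldFbar; letI := T.instAlgebraFbar
    letI := T.instAlgebraKFbar; letI := T.instIsElliptic
    ∀ {logvK : PadicLogsVal T.K} (hlog : LogvAnalyticVal logvK) (r : ThetaData.IdeleData T.D) (M : Type) [Field M] [NumberField M]
      (archPk : ∀ (j : (thetaIndexOfInitial T.D).Label) (vQ : (thetaIndexOfInitial T.D).VQ),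
        Set ((logShellsOfInitialDH T.D logvK).Packet j vQ))
      (archSub : ∀ (j : (thetaIndexOfInitial T.D).Label) (v : (thetaIndexOfInitial T.D).V),
        Set ((logShellsOfInitialDH T.D logvK).Packet j ((thetaIndexOfInitial T.D).over v)))
      (Ψ : ℤ → ∀ v : (thetaIndexOfInitial T.D).V, v ∈ (thetaIndexOfInitial T.D).Vbad →
        Set ((logShellsOfInitialDH T.D logvK).StarPacket v))
      (act : ℤ → ∀ v : (thetaIndexOfInitial T.D).V, v ∈ (thetaIndexOfInitial T.D).Vbad →
        (logShellsOfInitialDH T.D logvK).StarPacket v → Module.End ℚ ((logShellsOfInitialDH T.D logvK).StarPacket v))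
      (Mmod : ℤ → ∀ j : (thetaIndexOfInitial T.D).LabelStar, Set ((logShellsOfInitialDH T.D logvK).GlobalPacket j.1))
      (region : ℤ → ∀ j : (thetaIndexOfInitial T.D).LabelStar, FinDivisor M → ∀ vQ : (thetaIndexOfInitial T.D).VQ,
        Set ((logShellsOfInitialDH T.D logvK).Packet j.1 vQ))
      (n : ℤ) {HT : Type} {LogLink : HT → HT → Type} {IsFull : ∀ {s t : HT}, LogLink s t → Prop}
      (lat : LGPGaussianLogThetaLattice LogLink IsFull)
      {Frd : Type} {IsoF : Frd → Frd → Type} {Ob : Frd → Type} {realify : Frd → Frd} {Strip : Type}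
      {IsoS : Strip → Strip → Type}
      {Mv : ∀ v : (thetaIndexOfInitial T.D).V, v ∈ (thetaIndexOfInitial T.D).Vbad → Type} [∀ v h, Monoid (Mv v h)]
      (sig : GlobalLGPFrobenioidSignature (thetaIndexOfInitial T.D).lstar (thetaIndexOfInitial T.D).V
        (· ∈ (thetaIndexOfInitial T.D).Vbad) Frd IsoF Ob realify Strip IsoS Mv)
      (split : SplittingMonoids Mv) {ObΔ : Type}
      {N : ∀ v : (thetaIndexOfInitial T.D).V, v ∈ (thetaIndexOfInitial T.D).Vbad → Type} [∀ v h, Monoid (N v h)]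
      (qData : QPilotData ObΔ N)
      (htq0 : ∀ (u : FinitePlace ℚ) (x : (thetaIndexOfInitial T.D).Fibre (Val.non u)),
        tqM T.D (ratChar u) u (natCast_ratChar_mem u) r x ≠ 0)
      (Sq : Finset (FinitePlace ℚ))
      (htq1 : ∀ (u : FinitePlace ℚ) (x : (thetaIndexOfInitial T.D).Fibre (Val.non u)), u ∉ Sq →
        ‖tqM T.D (ratChar u) u (natCast_ratChar_mem u) r x‖ = 1),
      Thm311ToCor312.Licence
        (settingPrVolSharpM T.D hlog (tOfIdeleData T.D r) (fun u x => tqM T.D (ratChar u) u (natCast_ratChar_mem u) r x) M archPk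
          archSub Ψ act Mmod region n lat sig split qData htq0 Sq htq1) := by
  classical
  letI := T.instFieldF; letI := T.instNumberFieldF; letI := T.instAlgebraF; letI := T.instFieldK
  letI := T.instNumberFieldK; letI := T.instAlgebraK; letI := T.instFieldFbar; letI := T.instAlgebraFbar
  letI := T.instAlgebraKFbar; letI := T.instIsElliptic
  intro logvK hlog r M _ _ archPk archSub Ψ act Mmod region n HT LogLink IsFull lat Frd IsoF Ob realify Strip IsoS Mv _ sig split ObΔ N _
    qData htq0 Sq htq1
  have hjF : T.E.j = ((jInv ((a : ℚ) / c) : ℚ) : T.F) := by rw [T.j_eq]; exact eq_ratCast _ _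
  have hjr : T.E.j ∈ Set.range (algebraMap ℚ T.F) := ⟨jInv ((a : ℚ) / c), by rw [hjF, eq_ratCast]⟩
  have hlstar : (thetaIndexOfInitial T.D).lstar = (l - 1) / 2 := by
    show ((ThetaData.pilotData T.D).l - 1) / 2 = (l - 1) / 2
    rw [ThetaData.pilotData_l]
  have ha : 0 < a := habc.1
  have hb : 0 < b := habc.2.1
  have hc : 0 < c := by have := habc.2.2.1; omega
  have habc0 : a * b * c ≠ 0 := by positivity
  -- at a prime `p ∣ c`: `ord_p(a/c) = −v_p(c) = −v_p(abc)` (W-row-1, verbatim)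
  have hordq : ∀ pp : Nat.Primes, (pp : ℕ) ∣ c → ∀ v : HeightOneSpectrum (𝓞 ℚ), Rat.HeightOneSpectrum.natGenerator v = pp →
      ord ℚ v ((a : ℚ) / c) = -(((a * b * c).factorization pp : ℕ) : ℤ) := by
    intro pp hpc v hv
    haveI : Fact (pp : ℕ).Prime := ⟨pp.2⟩
    have hac : Nat.Coprime a c := by rw [← habc.2.2.1]; exact Nat.coprime_self_add_right.mpr habc.2.2.2
    have hbc : Nat.Coprime b c := by rw [← habc.2.2.1]; exact Nat.coprime_add_self_right.mpr habc.2.2.2.symm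
    have hpa : ¬ (pp : ℕ) ∣ a := fun hpa => by
      have h1 : (pp : ℕ) ∣ 1 := by have h := Nat.dvd_gcd hpa hpc; rwa [Nat.Coprime.gcd_eq_one hac] at h
      exact pp.2.one_lt.ne' (Nat.eq_one_of_dvd_one h1)
    have hpb : ¬ (pp : ℕ) ∣ b := fun hpb => by
      have h1 : (pp : ℕ) ∣ 1 := by have h := Nat.dvd_gcd hpb hpc; rwa [Nat.Coprime.gcd_eq_one hbc] at h
      exact pp.2.one_lt.ne' (Nat.eq_one_of_dvd_one h1)
    have hfac : (a * b * c).factorization pp = c.factorization pp := by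
      rw [Nat.factorization_mul (Nat.mul_ne_zero ha.ne' hb.ne') hc.ne', Nat.factorization_mul ha.ne' hb.ne', Finsupp.add_apply,
        Finsupp.add_apply, Nat.factorization_eq_zero_of_not_dvd hpa, Nat.factorization_eq_zero_of_not_dvd hpb, zero_add, zero_add]
    have hq0 : ((a : ℚ) / c) ≠ 0 := div_ne_zero (by exact_mod_cast ha.ne') (by exact_mod_cast hc.ne')
    rw [GenuineK.ord_rat_eq_padicValRat v hq0, hv, padicValRat.div (by exact_mod_cast ha.ne') (by exact_mod_cast hc.ne'),
      padicValRat.of_nat, padicValRat.of_nat, padicValNat.eq_zero_of_not_dvd hpa, hfac, Nat.factorization_def c pp.2]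
    simp
  -- the K-fibre point on the place of a member, and badness transported to the K datum
  set X := pilotDataOfK T.D T.K with hX
  have hKpt : ∀ (u : FinitePlace ℚ) (x : (thetaIndexOfInitial T.D).Fibre (Val.non u)),
      ∃ x' : (thetaIndex X).Fibre (.inr ⟨ratChar u, Fact.out⟩),
        placeOf X (ratChar u) x' = placeOfM T.D u x := by
    intro u x
    refine ⟨(fibreEquivPlacesOver X ⟨ratChar u, Fact.out⟩).symm
      ⟨placeOfM T.D u x, placeOfM_mem_placesOver T.D (ratChar u) u (natCast_ratChar_mem u) x⟩, ?_⟩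
    show (fibreEquivPlacesOver X ⟨ratChar u, Fact.out⟩ ((fibreEquivPlacesOver X ⟨ratChar u, Fact.out⟩).symm _)).1 = _
    rw [Equiv.apply_symm_apply]
  have hbadK : ∀ (u : FinitePlace ℚ) (x : (thetaIndexOfInitial T.D).Fibre (Val.non u)),
      placeModOfM T.D u x ∈ (ThetaData.pilotData T.D).S → placeOfM T.D u x ∈ X.S := by
    intro u x hx
    rw [hX, mem_pilotDataOfK_S_iff, ThetaData.mk_mem_VFbad_iff]
    rw [ThetaData.pilotData_S] at hx
    exact hx
  -- the per-place index `e_u`: the actual index at a bad member (singleton fibre: `j` is rational)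
  set eF : FinitePlace ℚ → ℕ := fun u =>
    if h : ∃ x : (thetaIndexOfInitial T.D).Fibre (Val.non u), placeModOfM T.D u x ∈ (ThetaData.pilotData T.D).S
    then absRamificationIdx (ratChar u) (kOfM T.D (ratChar u) u (natCast_ratChar_mem u) h.choose) else 1 with heF
  set vF : FinitePlace ℚ → ℕ := fun u => (a * b * c).factorization (ratChar u) with hvF
  set DF : FinitePlace ℚ → ℕ := fun u =>
    if ratChar u ∣ 30 ∧ ¬ ratChar u ∣ vF u then 2 * eF u - 1 else eF u - 1 with hDF
  set PF : FinitePlace ℚ → ℕ := fun u => eF u * (2 * vF u) / (2 * l) with hPF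
  set rinF : FinitePlace ℚ → ℤ := fun u => if ratChar u ∣ 30 then (((eF u / (ratChar u - 1) : ℕ) : ℤ)) else (1 : ℤ) with hrinF
  set routF : FinitePlace ℚ → ℤ := fun u =>
    min (((ratChar u : ℕ) : ℤ) ^ A (ratChar u) - (A (ratChar u) : ℤ) * (eF u : ℤ))
      (((ratChar u : ℕ) : ℤ) ^ B (ratChar u) - (B (ratChar u) : ℤ) * (eF u : ℤ)) with hroutF
  have heq : ∀ (u : FinitePlace ℚ) (x : (thetaIndexOfInitial T.D).Fibre (Val.non u)),
      placeModOfM T.D u x ∈ (ThetaData.pilotData T.D).S →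
        absRamificationIdx (ratChar u) (kOfM T.D (ratChar u) u (natCast_ratChar_mem u) x) = eF u := by
    intro u x hx
    have hex : ∃ x : (thetaIndexOfInitial T.D).Fibre (Val.non u), placeModOfM T.D u x ∈ (ThetaData.pilotData T.D).S := ⟨x, hx⟩
    have h1 : eF u = absRamificationIdx (ratChar u) (kOfM T.D (ratChar u) u (natCast_ratChar_mem u) hex.choose) := by
      simp only [heF, dif_pos hex]
    rw [h1, fibre_eq_of_j_mem_range T.D hjr u x hex.choose]
  -- everything the tree knows at a bad member
  have hfacts : ∀ (u : FinitePlace ℚ) (x : (thetaIndexOfInitial T.D).Fibre (Val.non u)),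
      placeModOfM T.D u x ∈ (ThetaData.pilotData T.D).S →
        ratChar u ∣ a * b * c ∧ ratChar u ≠ 2 ∧ ratChar u ≠ l ∧ 0 < vF u ∧
        (∀ v : HeightOneSpectrum (𝓞 ℚ), Rat.HeightOneSpectrum.natGenerator v = ratChar u →
          ord ℚ v (jInv ((a : ℚ) / c)) = -(2 * ((vF u : ℕ) : ℤ))) ∧
        0 < eF u ∧ l ∣ eF u ∧ 15 * l ∣ eF u * vF u ∧ (ratChar u ∣ 30 → (ratChar u - 1) ∣ eF u) ∧
        (ratChar u ∣ c → Odd (vF u) → 30 * l ∣ eF u * vF u) ∧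
        (ratChar u ∣ 30 → ¬ ratChar u ∣ vF u →
          ((2 * eF u - 1 : ℕ) : ℝ) / (eF u : ℝ) ≤ differentOrd (ratChar u) (kOfM T.D (ratChar u) u (natCast_ratChar_mem u) x)) := by
    intro u x hx
    set pp : Nat.Primes := ⟨ratChar u, Fact.out⟩ with hpp
    have hE := heq u x hx
    obtain ⟨x', hx'⟩ := hKpt u x
    have hxS : placeOf X pp.1 x' ∈ X.S := by rw [hx']; exact hbadK u x hx
    -- place-level identities between the K-fibre point and the member
    have heK : absRamificationIdx (pp : ℕ) (kOf X pp.1 x') = absRamificationIdx (ratChar u) (kOfM T.D (ratChar u) u (natCast_ratChar_mem u) x) := by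
      show absRamificationIdx (ratChar u) (kOf X (ratChar u) x') = _
      rw [absRamificationIdx_rescaledCompletion, absRamificationIdx_rescaledCompletion, hx']
    have hdK : differentOrd (pp : ℕ) (kOf X pp.1 x') = differentOrd (ratChar u) (kOfM T.D (ratChar u) u (natCast_ratChar_mem u) x) := by
      show differentOrd (ratChar u) (kOf X (ratChar u) x') = _
      rw [differentOrd_rescaledCompletion, differentOrd_rescaledCompletion, hx']
    have hdvd : (pp : ℕ) ∣ a * b * c := Cor312Prov.natCast_dvd_of_placeOf_mem_S_triple T.D habc hjF pp x' hxS
    obtain ⟨h2, hl⟩ := ne_two_and_ne_l_of_placeOf_mem_S_pilotDataOfK T.D pp x' hxS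
    have hv : 0 < vF u := Nat.Prime.factorization_pos_of_dvd pp.2 habc0 hdvd
    have hpole : ∀ v : HeightOneSpectrum (𝓞 ℚ), Rat.HeightOneSpectrum.natGenerator v = pp →
        ord ℚ v (jInv ((a : ℚ) / c)) = -(2 * (((a * b * c).factorization pp : ℕ) : ℤ)) := by
      intro v hv'
      rw [Cor22.ord_jInv_ratPoint_triple_eq habc v (by rw [hv']; exact h2) (by rw [hv']; exact hdvd), hv']
    have hpole' : ∀ v : HeightOneSpectrum (𝓞 ℚ), Rat.HeightOneSpectrum.natGenerator v = pp →
        ord ℚ v (jInv ((a : ℚ) / c)) < 0 := by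
      intro v hv'
      rw [hpole v hv']
      have : (0 : ℤ) < (a * b * c).factorization pp := by exact_mod_cast hv
      linarith
    have hpos := absRamificationIdx_pos (pp : ℕ) (kOf X pp.1 x')
    have hle := GenuineK.prime_dvd_absRamificationIdx_kOf_ratPoint T pp h2 hl hpole' x'
    have h15 := GenuineK.fifteen_mul_prime_dvd_absRamificationIdx_kOf_mul_ratPoint T pp h2 hl hv hpole x'
    have h30 : (pp : ℕ) ∣ 30 → ((pp : ℕ) - 1) ∣ absRamificationIdx (pp : ℕ) (kOf X pp.1 x') :=
      fun h => GenuineK.sub_one_dvd_absRamificationIdx_kOf T pp h x'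
    have hodd : (pp : ℕ) ∣ c → Odd ((a * b * c).factorization pp) →
        30 * l ∣ absRamificationIdx (pp : ℕ) (kOf X pp.1 x') * (a * b * c).factorization pp :=
      fun hpc ho => GenuineK.thirty_mul_prime_dvd_absRamificationIdx_kOf_mul_of_odd_pole T hj1728 pp h2 hl ho (hordq pp hpc) x'
    have hwild : (pp : ℕ) ∣ 30 → ¬ (pp : ℕ) ∣ (a * b * c).factorization pp →
        ((2 * absRamificationIdx (pp : ℕ) (kOf X pp.1 x') - 1 : ℕ) : ℝ) / (absRamificationIdx (pp : ℕ) (kOf X pp.1 x') : ℝ) ≤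
          differentOrd (pp : ℕ) (kOf X pp.1 x') :=
      fun h30' hnd => GenuineK.sub_one_div_le_differentOrd_kOf_wild_ratPoint T pp h30' h2 hv hnd hpole x'
    rw [heK, hE] at hpos hle h15 h30 hodd hwild
    rw [hdK] at hwild
    exact ⟨hdvd, h2, hl, hv, hpole, hpos, hle, h15, h30, hodd, hwild⟩
  refine WRowM.licence_tOfIdeleData_of_orders_rat T.D hlog r M archPk archSub Ψ act Mmod region n lat sig split qData htq0 Sq htq1 hjr
    eF DF PF rinF routF (fun u x hx => ?_) (fun u hu i => ?_)
  · -- the local packages at a bad member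
    have hE := heq u x hx
    obtain ⟨hdvd, h2, hl, hv, hpole, hpos, hle, h15, h30, hodd, hwild⟩ := hfacts u x hx
    obtain ⟨hne, -⟩ := hcell (ratChar u) Fact.out hdvd h2 hl (eF u) hpos hle h15 h30 hodd
    refine ⟨hE, ?_, ?_, ?_, ?_⟩
    · by_cases hw : ratChar u ∣ 30 ∧ ¬ ratChar u ∣ vF u
      · rw [show DF u = 2 * eF u - 1 by simp only [hDF, if_pos hw]]
        exact hwild hw.1 hw.2
      · rw [show DF u = eF u - 1 by simp only [hDF, if_neg hw]]
        exact Cor312Prov.pred_div_le_differentOrd_of_eq (ratChar u) hE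
    · by_cases hw : ratChar u ∣ 30
      · exact WRow.inner_witness_slot (ratChar u) h2 hE (show rinF u = _ by simp only [hrinF, if_pos hw])
      · rw [show rinF u = 1 by simp only [hrinF, if_neg hw]]
        exact WRow.inner_witness_trivial (ratChar u) _ (eF u)
    · exact WRow.outer_member_min (ratChar u) hE hne (A (ratChar u)) (B (ratChar u)) rfl (by simp only [hroutF])
    · -- `‖t_{q,x}‖ = p^{ord_p j(a/c)/(2l)} = p^{−P/e}`, `P = e·2v_p/(2l)`
      rw [norm_tqM_eq_rpow_ord_rat T.D (ratChar u) u (natCast_ratChar_mem u) r x hx (jInv ((a : ℚ) / c)) hjF,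
        hpole _ (natGenerator_finBelow_placeModOfM T.D (ratChar u) u (natCast_ratChar_mem u) x)]
      congr 1
      have hdvd2 : 2 * l ∣ eF u * (2 * vF u) := by
        obtain ⟨k, hk⟩ := hle
        exact ⟨k * vF u, by rw [hk]; ring⟩
      rw [show PF u = eF u * (2 * vF u) / (2 * l) by simp only [hPF]]
      have hl0 : (0 : ℝ) < (l : ℝ) := by exact_mod_cast lt_of_lt_of_le (by norm_num) T.D.five_le_l
      have he0 : (0 : ℝ) < (eF u : ℝ) := by exact_mod_cast hpos
      have h2l : ((2 * l : ℕ) : ℝ) ≠ 0 := by push_cast; positivity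
      rw [Nat.cast_div hdvd2 h2l]
      push_cast
      field_simp
  · -- the integer cells at every label `j = i + 1 ≤ (l − 1)/2`
    obtain ⟨x, hx⟩ := hu
    obtain ⟨hdvd, h2, hl, hv, hpole, hpos, hle, h15, h30, hodd, -⟩ := hfacts u x hx
    have hi : (i : ℕ) < (l - 1) / 2 := hlstar ▸ i.isLt
    have hci := (hcell (ratChar u) Fact.out hdvd h2 hl (eF u) hpos hle h15 h30 hodd).2 i hi
    simp only [hDF, hPF, hvF, hrinF, hroutF]
    exact hci

end Summit.ABC.IUTFork.Conditional

end
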